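import Summits.QuantumFields.YangMills.Theorems.FluctuationComparisonRegPrIntLOrganTangentDwhiteOfRealCoercive
import Summits.QuantumFields.YangMills.Theorems.FluctuationComparisonRegPrIntLOrganTangentSquareOfTubeHolomorphic
import HarnessLib

/-!
# Crux `FluctuationComparisonRegPrIntL` (stmt-QuantumFields-20520, rung R3), PATH-B organ (covariant organ of record, RULING №56) — (L59) «D0's WHITENING LETTERS
# ON PRINT'S TWO OBJECTS»: the ABSTRACT whitening-kernel family `A V b w : ℂ → Matrix p p ℂ` of ✓p827976 ∕ ✓(L52) ∕ ✓(L57) and its FIVE letters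
# {(W-holo) `hA`, (W-maj) `hMx`, (W-read0) `hK0`, (W-real) `hreal`, (W-read) `hread`} are STRUCK from ✓(L57) `dwhite_of_whiteningKernel_coerciveCentre` in favour of
# print's two OBJECTS — ONE complexified fluctuation operator `Kc` on Bałaban's complex TUBE ([Balaban1987RG1] (1.11)–(1.18); [Balaban1985BackgroundPropagators]
# Thm 3.4 p.400) and the REAL fluctuation operator `K V` — read along the complex ONE-BOND SLICE of ✓p827459 ∕ ✓p828173 (`exists_cplxSquare` at `t = 0`); the
# family is INSTANTIATED inside the proof as `u ↦ Kc (Sl_{V,b,w} u)`; CONCLUSION = ✓(L52)'s = ✓(L50b)'s `hDwhite` binder text VERBATIM.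

Cell `ym3-torus` (YM ladder rung R3 = continuum `SU(2)` Yang–Mills on the three-torus — a RUNG: NOT d = 4, NOT infinite volume, NOT a mass gap, NOT Clay).
Width seat `ym-ust-20520-w5` (gen 27), `--kind proof --supports stmt-QuantumFields-20520 --as helper`, count-neutral, DEFINITION-FREE, default heartbeats,
no registry ∕ binder ∕ `Lines/` edit.  Over ✓p833103 (L57) `…OrganTangentDwhiteOfRealCoercive` (this seat), ✓p828173 `…OrganTangentSquareOfTubeHolomorphic` (px19 g23:
`exists_cplxSquare`), lit ✓`B13Sqrt27Accretive` (`invSqrt`), lit ✓`QGQInverse` (`Coercive`), lit ✓`B13RealSliceEntryLetters` (`realStructureComplex`, `lam`).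

THE LETTERS AFTER (L59) (hypothesis texts; `V` a `θ_j`-small coarse field, `V′` a `θ⁺`-small one, `b` a coarse bond, `w` a unit direction):
* (K-tube) «`Kc : (PBond → M₂(ℂ)) → Matrix p p ℂ` is ENTRYWISE holomorphic on `cplxTube δt V` around every `θ_j`-small `V`, with ONE entrywise majorant `Mx` of absolute
  row∕column sums `≤ S` there» — ✓p828173's `hK`∕`hKM` currency (UV3-NODE §92.2 L2-c: [Balaban1987RG1] (1.5) p.261 «analytic functions of the configurations»,
  (1.18) p.263; [Balaban1985BackgroundPropagators] Thm 3.4 p.400, (3.23)–(3.26) locality).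
* (K-real) «`Kc (ι V′) = (K V′).map ofReal`» on the enlarged window `θ⁺` — the complex extension READS the real operator at embedded real configurations.
* (K-coer) «`Coercive (K V) γK`», ONE `γK > 0` — [Balaban1985BackgroundPropagators] Thm 3.11 p.416 ∕ p.428, REAL, AS PRINTED (L2-a).
* (K-sqrt-decay) «`‖invSqrt ((K V′).map ofReal) i j′‖ ≤ B·e^{−ρ d(i,j′)}`» on `θ⁺` — [Balaban1988RG2Cluster] (2.7) p.13 + [Balaban1985BackgroundPropagators] Thm 3.10 (L2-b).
* (Wh-read-K) «`Wh V′ z e k = ((invSqrt ((K V′).map ofReal) *ᵥ coord z) (idx e k)).re`» for `θ_j`-small `V′` — the chart's STRUCTURE identity: the organ's whitened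
  coordinate IS `K_{V′}^{−1∕2}·coord z` ([Balaban1988RG2Cluster] (2.5)–(2.6) p.12: whitening by `(C^{(k)})^{1∕2}`; RULING №54 `Wh V z = K_V^{−1∕2} z`).
* (window⁺) «`θ_j`-small ⟹ `θ⁺`-small» and (room) «one-bond moves `update V b (V b·expPt u)`, `‖u‖ < R₁`, of a `θ_j`-small `V` are `θ⁺`-small» — window kinematics.
* radii: slice∕tube radius `rt` with `e^{6 rt} ≤ 1 + δt` (✓p827459), thin radius `0 < R₁ ≤ rt` with `2S·R₁∕rt ≤ γK∕2` (✓(L57)), `0 < r < 1`, guard `δ₀ < (r∕(1+r))·R₁∕2`;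
  (z-window∣MW) `hwin`, `kW`, `hkW` VERBATIM from ✓(L57) (constants at `(γK∕2, R₁)`).
INHABITATION (★★OWNER RULING №100): LAW-FREE — statements about the chart objects `Kc`, `K`, `Wh`, `coord` pointwise; no fibre law, no score, no cross-law object.

WHAT (sorry-free, def-free).
* §1 ★★`exists_cplxSlice` — THE COMPLEX ONE-BOND SLICE AS AN OBJECT (✓`exists_cplxSquare` at `b′ := b`, `t := 0`): for `U`, bond `b`, sup-unit direction `w`, `0 < rt`,
  `e^{6 rt} ≤ 1 + δt` there is `Sl : ℂ → (bonds → M₂(ℂ))`, ENTIRE, mapping `ball 0 rt` into `cplxTube δt U`, with `Sl 0 = ι∘U` and `Sl ↑s = ι∘V` for the REAL one-bond move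
  `V = U·expPt(s•w)@b`.
* §2 ★★★`dwhite_of_tubeOperator` — ✓(L57) `dwhite_of_whiteningKernel_coerciveCentre` with the abstract family `A` and its five letters `hK0 hA hMx hreal hread` DELETED and
  `(Kc) (θp, hwinp) (δt rt, hrt0, hrt) (hKc, hKM) (hKreal) (hdec on θ⁺) (hroom) (hWh)` in their place; CONCLUSION = ✓(L52)'s VERBATIM.  Proof: `choose` the slices of §1,
  instantiate `A V b w u := Kc (Sl V b w u)` (for `‖w‖ ≤ 1`), discharge the five letters ((W-holo): entry holomorphy ∘ slice, `DifferentiableOn.comp` + `MapsTo`;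
  (W-maj): tube majorant on the slice's image; (W-read0): `Sl 0 = ι V` + (K-real); (W-real): at a real parameter `↑s`, `‖↑s‖ < R₁`, the slice is `ι(V·e^{sw}@b)`, a
  `θ⁺`-small field by (room), so (K-real) + (K-sqrt-decay); (W-read): the same + (Wh-read-K) at the moved `θ_j`-small field), then ✓(L57) by name.
* §3 ★★★`dwhite_of_tubeOperator_window` — §2 with `θ⁺ := θBal + 4·√3·R₁` FIXED and the kinematic letters (window⁺), (room) PROVED (✓`plaqSmall_mono`, ✓`plaqSmall_relPath`:
  [Balaban1985Averaging] (9) p.19); letters left = {(K-tube), (K-real), (K-coer), (K-sqrt-decay), (Wh-read-K), (z-window∣MW), `hkW`, radii}.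
NET: after ✓(L57) + ✓(L58) + (L59) the D0 whitening side AND (xv)'s corners read off ONE pair `(Kc, K)` with letters = {L2-c (tube holomorphy + majorant), L2-a (REAL
coercivity), L2-b (real-slice square-root decay), the structure identity (Wh-read-K), window kinematics} — every item printed or structural; no abstract family, no
complex-ball margin, no corner-inverse letter remains.

HONEST FRAMING: bookkeeping — a re-issue of a landed door with an explicit slice construction already kernel in ✓p827459∕✓p828173; the letters (K-tube), (K-real),
(K-coer), (K-sqrt-decay), (Wh-read-K), (window⁺), (room), (z-window∣MW) are D0's ∕ print's content (crux 19200 EX ∧ V2′; [Balaban1985BackgroundPropagators] §3) and are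
NOT proved here; (Dmin), (χ-Lip∣MW), (I-curv), (I-cov), KER′ letters, rows v0.1–v0.4ᴱ UNDISCHARGED; nothing of Bałaban's analysis is asserted or proved; the five registered
stubs of `Lines/semiclassical_s2beta.lean`, crux 20520 and `YM3TorusSU2` are NOT proved; registry untouched; rung R3 = SU(2) YM₃ on T³ — NOT d = 4, NOT infinite volume,
NOT a mass gap, NOT Clay; the Yang–Mills mass gap is NOT proved.  [folklore]

References: T. Bałaban, CMP **109** (1987) 249–301 [Balaban1987RG1] ((1.5) p.261, (1.11)–(1.18) pp.262–263); CMP **99** (1985) 389–434 [Balaban1985BackgroundPropagators]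
(Thm 3.4 p.400, Thm 3.10 (3.108) p.416, Thm 3.11 p.416, p.428); CMP **116** (1988) 1–22 [Balaban1988RG2Cluster] ((2.5)–(2.7) pp.12–13, p.15).
-/

set_option autoImplicit false

noncomputable section

namespace Summit.QuantumFields.YangMills.Theorems.OrganTangentDwhiteOfTubeOperator

open Function Set Metric Finset
open scoped NNReal Matrix Matrix.Norms.L2Operator
open Literature.MathematicalPhysics.QuantumFieldTheory
open Literature.MathematicalPhysics.QuantumFieldTheory.Balaban1983to89 T3ContinuumYM3Torus T3NestedUnitLaws
  T3UnitLawDensityEML T4Continuum BalabanUVClass T3UnitScaleTilt T3LevelShift T3TiltDescent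
open T4CubeChartExp (expPt expPt_zero)
open BalabanUVClass (CplxModel)
open Literature.MathematicalPhysics.QuantumFieldTheory.Balaban1983to89.B9Thm37GlueTorus (tdist1)
open Literature.MathematicalPhysics.QuantumFieldTheory.Balaban1983to89.B5TorusCover (UT)
open Literature.MathematicalPhysics.QuantumFieldTheory.Balaban1983to89.B13Sqrt27Accretive (invSqrt)
open Literature.MathematicalPhysics.QuantumFieldTheory.Balaban1983to89.B13RealSliceEntryLetters (realStructureComplex lam)
open Literature.MathematicalPhysics.QuantumFieldTheory.Balaban1983to89.QGQInverse (Coercive)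
open Summit.QuantumFields.YangMills.Theorems.OrganTangentSquareOfTubeHolomorphic (exists_cplxSquare)
open Summit.QuantumFields.YangMills.Theorems.OrganTangentDwhiteOfRealCoercive (dwhite_of_whiteningKernel_coerciveCentre)
open Summit.QuantumFields.YangMills.Theorems.OrganTangentILawKnitFacts (plaqSmall_mono)
open Summit.QuantumFields.YangMills.Theorems.OrganTangentRelPathWindow (plaqSmall_relPath)

/-! ## §1 The complex one-bond slice as an object -/

section Slice

variable {P : Params} {j : ℕ} [DecidableEq (PBond P j)]

/-- ★★ **THE COMPLEX ONE-BOND SLICE** through `U` at bond `b` in the sup-unit direction `w` (radius `rt > 0` with `e^{6 rt} ≤ 1 + δt`): an ENTIRE map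
`Sl : ℂ → (bonds → M₂(ℂ))` mapping `ball 0 rt` into the tube `cplxTube δt U`, equal to `ι∘U` at `0` and to the embedded REAL one-bond move `ι∘V`,
`V = U·expPt(s•w)@b`, at a real parameter `s` — ✓`exists_cplxSquare` at `b′ := b`, `t := 0`. [cite: Balaban1987RG1, (1.11)-(1.13) p.262] -/
theorem exists_cplxSlice (U : GaugeField P j (Matrix.specialUnitaryGroup (Fin 2) ℂ)) {δt rt : ℝ} (hrt0 : 0 < rt)
    (hrt : Real.exp (6 * rt) ≤ 1 + δt) (b : PBond P j) (w : Fin 3 → ℝ) (hw : ‖w‖ ≤ 1) :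
    ∃ Sl : ℂ → (PBond P j → Matrix (Fin 2) (Fin 2) ℂ),
      Differentiable ℂ Sl ∧
      MapsTo Sl (ball (0 : ℂ) rt) ((CplxModel.specialUnitary (Fin 2)).cplxTube δt U) ∧
      Sl 0 = (CplxModel.specialUnitary (Fin 2)).embed U ∧
      ∀ (s : ℝ) (V : GaugeField P j (Matrix.specialUnitaryGroup (Fin 2) ℂ)),
        (∀ e, e ≠ b → V e = U e) → V b = U b * expPt (s • w) →
        Sl (s : ℂ) = (CplxModel.specialUnitary (Fin 2)).embed V := by
  obtain ⟨Φ, hΦd, hΦm, hΦ0, hΦr⟩ := exists_cplxSquare U hrt b b w w hw hw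
  refine ⟨fun u => Φ (u, 0), ?_, ?_, ?_, ?_⟩
  · have h2 : Differentiable ℂ (fun u : ℂ => ((u, 0) : ℂ × ℂ)) := differentiable_id.prodMk (differentiable_const _)
    exact hΦd.comp h2
  · intro u hu
    exact hΦm (mk_mem_prod hu (mem_ball_self hrt0))
  · show Φ ((0 : ℂ), (0 : ℂ)) = _
    rw [Prod.mk_zero_zero]; exact hΦ0
  · intro s V hV hVb
    have h := hΦr s 0 V V hV hVb (fun e _ => rfl) (by rw [zero_smul, expPt_zero, mul_one])
    simpa using h

end Slice

/-! ## §2 (Dwhite∣MW) on print's two objects -/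

section Dock

variable {ν : ℕ} {Nf : Fin ν → ℕ} [∀ i, NeZero (Nf i)]
variable {p : Type} [Fintype p] [DecidableEq p]

/-- ★★★ **(Dwhite∣MW) ON PRINT'S TWO OBJECTS** — ✓(L57) `dwhite_of_whiteningKernel_coerciveCentre` with the abstract family `A` and its letters `hK0 hA hMx hreal hread`
DELETED and, in their place: ONE complexified operator `Kc` with (K-tube) entrywise holomorphy + majorant on the tube around every `θ_j`-small `V` (✓p828173's currency,
L2-c), the REAL operator `K` with (K-real) on `θ⁺`, (K-coer) (L2-a, real, as printed), (K-sqrt-decay) on `θ⁺` (L2-b), the structure identity (Wh-read-K), and window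
kinematics (window⁺)∕(room); radii `rt` (slice), `R₁` (thin), `r`, `δ₀`; (z-window∣MW)∕`kW`∕`hkW` VERBATIM.  CONCLUSION = ✓(L52)'s = ✓`dlinkPath∕Square_of_dmin_dwhite`'s
`hDwhite` text VERBATIM.  Proof: the slices of §1 (`choose`), `A V b w u := Kc (Sl_{V,b,w} u)`, five letters discharged, ✓(L57) by name.
[cite: Balaban1987RG1, (1.11)-(1.18) pp.262-263; Balaban1985BackgroundPropagators, Thm 3.4 p.400, Thm 3.10 (3.108) p.416, Thm 3.11 p.416, p.428; Balaban1988RG2Cluster, (2.5)-(2.7) pp.12-13, p.15] -/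
theorem dwhite_of_tubeOperator (F : T3Family) (γ b₀ p₀ : ℝ) (j Ts : ℕ) {Z : Type}
    (Φ : GaugeField (F.P j) 0 ↥(Matrix.specialUnitaryGroup (Fin 2) ℂ) × Z → GaugeField (F.P Ts) 0 ↥(Matrix.specialUnitaryGroup (Fin 2) ℂ))
    (Wh : GaugeField (F.P j) 0 ↥(Matrix.specialUnitaryGroup (Fin 2) ℂ) → Z → PBond (F.P Ts) 0 → (Fin 3 → ℝ))
    (loc : p → UT Nf) (idx : PBond (F.P Ts) 0 → Fin 3 → p) (coord : Z → p → ℂ)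
    -- PRINT'S TWO OBJECTS: the complexified fluctuation operator on the tube, the real fluctuation operator
    (Kc : (PBond (F.P j) 0 → Matrix (Fin 2) (Fin 2) ℂ) → Matrix p p ℂ)
    (K : GaugeField (F.P j) 0 ↥(Matrix.specialUnitaryGroup (Fin 2) ℂ) → Matrix p p ℝ)
    -- the enlarged window on which the real letters are read, and the slice ∕ tube radii
    (θp : ℝ) (hwinp : ∀ V : GaugeField (F.P j) 0 ↥(Matrix.specialUnitaryGroup (Fin 2) ℂ), PlaqSmall (θBal F.L γ b₀ p₀ j) V → PlaqSmall θp V)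
    (δt rt : ℝ) (hrt0 : 0 < rt) (hrt : Real.exp (6 * rt) ≤ 1 + δt)
    -- (K-tube): entrywise holomorphy + ONE entrywise majorant on the tube around every `θ_j`-small `V` (L2-c currency of ✓p828173)
    (Mx : p → p → ℝ) (S : ℝ) (hS : 0 ≤ S) (hrow : ∀ i, ∑ j', Mx i j' ≤ S) (hcol : ∀ j', ∑ i, Mx i j' ≤ S)
    (hKc : ∀ V : GaugeField (F.P j) 0 ↥(Matrix.specialUnitaryGroup (Fin 2) ℂ), PlaqSmall (θBal F.L γ b₀ p₀ j) V →
      ∀ i j', DifferentiableOn ℂ (fun W => Kc W i j') ((CplxModel.specialUnitary (Fin 2)).cplxTube δt V))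
    (hKM : ∀ V : GaugeField (F.P j) 0 ↥(Matrix.specialUnitaryGroup (Fin 2) ℂ), PlaqSmall (θBal F.L γ b₀ p₀ j) V →
      ∀ W ∈ (CplxModel.specialUnitary (Fin 2)).cplxTube δt V, ∀ i j', ‖Kc W i j'‖ ≤ Mx i j')
    -- (K-real): the complex extension reads the real operator at embedded real `θ⁺`-small configurations
    (hKreal : ∀ V' : GaugeField (F.P j) 0 ↥(Matrix.specialUnitaryGroup (Fin 2) ℂ), PlaqSmall θp V' →
      Kc ((CplxModel.specialUnitary (Fin 2)).embed V') = (K V').map (algebraMap ℝ ℂ))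
    -- (K-coer): L2-a, REAL, at the `θ_j`-small centres
    (γK : ℝ) (hγK : 0 < γK)
    (hcoer : ∀ V : GaugeField (F.P j) 0 ↥(Matrix.specialUnitaryGroup (Fin 2) ℂ), PlaqSmall (θBal F.L γ b₀ p₀ j) V → Coercive (K V) γK)
    -- (K-sqrt-decay): L2-b at real `θ⁺`-small configurations
    (ρ B : ℝ) (hB0 : 0 ≤ B) (hρ : 0 ≤ ρ)
    (hdec : ∀ V' : GaugeField (F.P j) 0 ↥(Matrix.specialUnitaryGroup (Fin 2) ℂ), PlaqSmall θp V' →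
      ∀ i j', ‖invSqrt ((K V').map (algebraMap ℝ ℂ)) i j'‖ ≤ B * Real.exp (-(ρ * tdist1 Nf (loc i) (loc j'))))
    -- radii: thin radius `R₁ ≤ rt` with the margin condition, `0 < r < 1`, window bound `Zw`, reading window `δ₀`
    (R₁ r δ₀ Zw : ℝ) (hR₁ : 0 < R₁) (hR₁rt : R₁ ≤ rt) (hsmall : 2 * S * R₁ / rt ≤ γK / 2) (hr0 : 0 < r) (hr1 : r < 1) (hZw : 0 ≤ Zw)
    (hδ₀R : δ₀ < r / (1 + r) * R₁ / 2)
    -- (room): one-bond moves of size `< R₁` of a `θ_j`-small field are `θ⁺`-small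
    (hroom : ∀ (V : GaugeField (F.P j) 0 ↥(Matrix.specialUnitaryGroup (Fin 2) ℂ)) (b : PBond (F.P j) 0) (u : Fin 3 → ℝ), PlaqSmall (θBal F.L γ b₀ p₀ j) V →
      ‖u‖ < R₁ → PlaqSmall θp (update V b (V b * expPt u)))
    -- (Wh-read-K): the organ's whitened coordinate IS `K_{V′}^{-1/2}·coord` at `θ_j`-small fields
    (hWh : ∀ V' : GaugeField (F.P j) 0 ↥(Matrix.specialUnitaryGroup (Fin 2) ℂ), PlaqSmall (θBal F.L γ b₀ p₀ j) V' →
      ∀ (z : Z) (e : PBond (F.P Ts) 0) (k : Fin 3), Wh V' z e k = ((invSqrt ((K V').map (algebraMap ℝ ℂ)) *ᵥ coord z) (idx e k)).re)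
    -- (z-window∣MW): on the multiwindow-good open segment the fibre coordinates are window-bounded (VERBATIM)
    (hwin : ∀ (z : Z) (V : GaugeField (F.P j) 0 ↥(Matrix.specialUnitaryGroup (Fin 2) ℂ)) (b : PBond (F.P j) 0) (u : Fin 3 → ℝ), PlaqSmall (θBal F.L γ b₀ p₀ j) V →
      PlaqSmall (θBal F.L γ b₀ p₀ j) (update V b (V b * expPt u)) → ‖u‖ ≤ δ₀ →
      (∀ r ∈ Set.Ioo (0:ℝ) 1, ∀ (n : ℕ) (hjn : j + 1 ≤ n) (hnK : n ≤ Ts), PlaqSmall (24 / 25 * θBal F.L γ b₀ p₀ n) (descendTo F ℰp n Ts hnK (Φ (update V b (V b * expPt (r • u)), z)))) →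
      ∀ j', ‖coord z j'‖ ≤ Zw)
    -- the consumer's modulus dominates the row-sum shape at `(γK∕2, R₁)`, colour by colour (VERBATIM from ✓(L57))
    (kW : PBond (F.P Ts) 0 → ℝ)
    (hkW : ∀ e k, (4 / (r / (1 + r) * R₁)) *
          (∑ j', (B ^ (1 - lam r) * (max B (2 / Real.sqrt (γK / 2))) ^ lam r) * Real.exp (-((1 - lam r) * ρ * tdist1 Nf (loc (idx e k)) (loc j')))) * Zw ≤ kW e) :
    ∀ (z : Z) (V : GaugeField (F.P j) 0 ↥(Matrix.specialUnitaryGroup (Fin 2) ℂ)) (b : PBond (F.P j) 0) (u : Fin 3 → ℝ), PlaqSmall (θBal F.L γ b₀ p₀ j) V →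
      PlaqSmall (θBal F.L γ b₀ p₀ j) (update V b (V b * expPt u)) → ‖u‖ ≤ δ₀ →
      (∀ r ∈ Set.Ioo (0:ℝ) 1, ∀ (n : ℕ) (hjn : j + 1 ≤ n) (hnK : n ≤ Ts), PlaqSmall (24 / 25 * θBal F.L γ b₀ p₀ n) (descendTo F ℰp n Ts hnK (Φ (update V b (V b * expPt (r • u)), z)))) →
      ∀ e, ‖Wh (update V b (V b * expPt u)) z e - Wh V z e‖ ≤ kW e * ‖u‖ := by
  classical
  -- the complex one-bond slices, one per `(V, b, w)` with `‖w‖ ≤ 1`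
  choose Sl hSld hSlm hSl0 hSlr using
    fun (V : GaugeField (F.P j) 0 ↥(Matrix.specialUnitaryGroup (Fin 2) ℂ)) (b : PBond (F.P j) 0) (w : Fin 3 → ℝ) (hw : ‖w‖ ≤ 1) =>
      exists_cplxSlice V hrt0 hrt b w hw
  -- the real one-bond move agrees with `V` off `b` and is `V b·expPt(s•w)` at `b`
  have hmove : ∀ (V : GaugeField (F.P j) 0 ↥(Matrix.specialUnitaryGroup (Fin 2) ℂ)) (b : PBond (F.P j) 0) (w : Fin 3 → ℝ) (hw : ‖w‖ ≤ 1) (s : ℝ),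
      Sl V b w hw (s : ℂ) = (CplxModel.specialUnitary (Fin 2)).embed (update V b (V b * expPt (s • w))) :=
    fun V b w hw s => hSlr V b w hw s _ (fun e he => update_of_ne he _ _) (update_self _ _ _)
  -- a real one-bond move of size `< R₁` stays `θ⁺`-small
  have hsmallmove : ∀ (V : GaugeField (F.P j) 0 ↥(Matrix.specialUnitaryGroup (Fin 2) ℂ)) (b : PBond (F.P j) 0) (w : Fin 3 → ℝ), ‖w‖ ≤ 1 →
      PlaqSmall (θBal F.L γ b₀ p₀ j) V → ∀ s : ℝ, |s| < R₁ → PlaqSmall θp (update V b (V b * expPt (s • w))) := by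
    intro V b w hw hV s hs
    refine hroom V b (s • w) hV ?_
    calc ‖s • w‖ = |s| * ‖w‖ := by rw [norm_smul, Real.norm_eq_abs]
      _ ≤ |s| * 1 := mul_le_mul_of_nonneg_left hw (abs_nonneg s)
      _ < R₁ := by rw [mul_one]; exact hs
  refine dwhite_of_whiteningKernel_coerciveCentre F γ b₀ p₀ j Ts Φ Wh loc idx coord
    (fun V b w u => if hw : ‖w‖ ≤ 1 then Kc (Sl V b w hw u) else 0) K γK hγK ?_ hcoer Mx S hS hrow hcol rt R₁ ρ B r δ₀ Zw
    hR₁ hR₁rt hsmall hB0 hρ hr0 hr1 hZw hδ₀R ?_ ?_ ?_ ?_ hwin kW hkW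
  · -- (W-read0): at the centre the slice is `ι V`, where `Kc` reads `K V`
    intro V b w hV hw
    simp only [dif_pos hw]
    rw [hSl0, hKreal V (hwinp V hV)]
  · -- (W-holo): entry holomorphy on the tube ∘ the entire slice mapping the ball into the tube
    intro V b w hV hw i j'
    simp only [dif_pos hw]
    exact (hKc V hV i j').comp (hSld V b w hw).differentiableOn (hSlm V b w hw)
  · -- (W-maj): the tube majorant on the slice's image
    intro V b w hV hw u hu i j'
    simp only [dif_pos hw]
    exact hKM V hV _ (hSlm V b w hw hu) i j'
  · -- (W-real): at a real parameter the slice is a real `θ⁺`-small one-bond move; (K-real) + (K-sqrt-decay)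
    intro V b w hV hw v hv hvR i j'
    obtain ⟨s, rfl⟩ := hv
    have hs : |s| < R₁ := by rwa [Complex.norm_real, Real.norm_eq_abs] at hvR
    have hVs := hsmallmove V b w hw hV s hs
    simp only [dif_pos hw]
    rw [hmove V b w hw s, hKreal _ hVs]
    exact hdec _ hVs i j'
  · -- (W-read): the same reading at the moved `θ_j`-small field + (Wh-read-K)
    intro V b w s hV hw _ hVs z e k
    simp only [dif_pos hw]
    rw [hmove V b w hw s, hKreal _ (hwinp _ hVs)]
    exact hWh _ hVs z e k


/-! ## §3 The window kinematics discharged: `θ⁺ := θ_j + 4·√3·R₁` -/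

/-- ★★★ **(Dwhite∣MW) ON PRINT'S TWO OBJECTS, WINDOW KINEMATICS DISCHARGED** — §2 with the enlarged window FIXED at `θ⁺ := θBal + 4·√3·R₁` and the two
kinematic letters (window⁺) `hwinp`, (room) `hroom` PROVED (✓`plaqSmall_mono`; ✓`plaqSmall_relPath`: a one-bond move of size `‖u‖` widens the plaquette window by
`≤ 4·√3·‖u‖`, [Balaban1985Averaging] (9) p.19); the real letters (K-real), (K-sqrt-decay) are read on `PlaqSmall (θBal F.L γ b₀ p₀ j + 4·(√3·R₁))`.  Letters left:
(K-tube), (K-real), (K-coer), (K-sqrt-decay), (Wh-read-K), (z-window∣MW), `hkW`, radii.  CONCLUSION = ✓(L52)'s VERBATIM.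
[cite: Balaban1985Averaging, (9) p.19; Balaban1987RG1, (1.11)-(1.18) pp.262-263; Balaban1985BackgroundPropagators, Thm 3.4 p.400, Thm 3.11 p.416, p.428; Balaban1988RG2Cluster, (2.7) p.13, p.15] -/
theorem dwhite_of_tubeOperator_window (F : T3Family) (γ b₀ p₀ : ℝ) (j Ts : ℕ) {Z : Type}
    (Φ : GaugeField (F.P j) 0 ↥(Matrix.specialUnitaryGroup (Fin 2) ℂ) × Z → GaugeField (F.P Ts) 0 ↥(Matrix.specialUnitaryGroup (Fin 2) ℂ))
    (Wh : GaugeField (F.P j) 0 ↥(Matrix.specialUnitaryGroup (Fin 2) ℂ) → Z → PBond (F.P Ts) 0 → (Fin 3 → ℝ))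
    (loc : p → UT Nf) (idx : PBond (F.P Ts) 0 → Fin 3 → p) (coord : Z → p → ℂ)
    (Kc : (PBond (F.P j) 0 → Matrix (Fin 2) (Fin 2) ℂ) → Matrix p p ℂ)
    (K : GaugeField (F.P j) 0 ↥(Matrix.specialUnitaryGroup (Fin 2) ℂ) → Matrix p p ℝ)
    (δt rt : ℝ) (hrt0 : 0 < rt) (hrt : Real.exp (6 * rt) ≤ 1 + δt)
    -- (K-tube)
    (Mx : p → p → ℝ) (S : ℝ) (hS : 0 ≤ S) (hrow : ∀ i, ∑ j', Mx i j' ≤ S) (hcol : ∀ j', ∑ i, Mx i j' ≤ S)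
    (hKc : ∀ V : GaugeField (F.P j) 0 ↥(Matrix.specialUnitaryGroup (Fin 2) ℂ), PlaqSmall (θBal F.L γ b₀ p₀ j) V →
      ∀ i j', DifferentiableOn ℂ (fun W => Kc W i j') ((CplxModel.specialUnitary (Fin 2)).cplxTube δt V))
    (hKM : ∀ V : GaugeField (F.P j) 0 ↥(Matrix.specialUnitaryGroup (Fin 2) ℂ), PlaqSmall (θBal F.L γ b₀ p₀ j) V →
      ∀ W ∈ (CplxModel.specialUnitary (Fin 2)).cplxTube δt V, ∀ i j', ‖Kc W i j'‖ ≤ Mx i j')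
    -- (K-coer): L2-a, REAL, at the `θ_j`-small centres
    (γK : ℝ) (hγK : 0 < γK)
    (hcoer : ∀ V : GaugeField (F.P j) 0 ↥(Matrix.specialUnitaryGroup (Fin 2) ℂ), PlaqSmall (θBal F.L γ b₀ p₀ j) V → Coercive (K V) γK)
    -- radii
    (ρ B R₁ r δ₀ Zw : ℝ) (hB0 : 0 ≤ B) (hρ : 0 ≤ ρ) (hR₁ : 0 < R₁) (hR₁rt : R₁ ≤ rt) (hsmall : 2 * S * R₁ / rt ≤ γK / 2)
    (hr0 : 0 < r) (hr1 : r < 1) (hZw : 0 ≤ Zw) (hδ₀R : δ₀ < r / (1 + r) * R₁ / 2)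
    -- (K-real) and (K-sqrt-decay) on the enlarged window `θ_j + 4·√3·R₁`
    (hKreal : ∀ V' : GaugeField (F.P j) 0 ↥(Matrix.specialUnitaryGroup (Fin 2) ℂ), PlaqSmall (θBal F.L γ b₀ p₀ j + 4 * (Real.sqrt 3 * R₁)) V' →
      Kc ((CplxModel.specialUnitary (Fin 2)).embed V') = (K V').map (algebraMap ℝ ℂ))
    (hdec : ∀ V' : GaugeField (F.P j) 0 ↥(Matrix.specialUnitaryGroup (Fin 2) ℂ), PlaqSmall (θBal F.L γ b₀ p₀ j + 4 * (Real.sqrt 3 * R₁)) V' →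
      ∀ i j', ‖invSqrt ((K V').map (algebraMap ℝ ℂ)) i j'‖ ≤ B * Real.exp (-(ρ * tdist1 Nf (loc i) (loc j'))))
    -- (Wh-read-K)
    (hWh : ∀ V' : GaugeField (F.P j) 0 ↥(Matrix.specialUnitaryGroup (Fin 2) ℂ), PlaqSmall (θBal F.L γ b₀ p₀ j) V' →
      ∀ (z : Z) (e : PBond (F.P Ts) 0) (k : Fin 3), Wh V' z e k = ((invSqrt ((K V').map (algebraMap ℝ ℂ)) *ᵥ coord z) (idx e k)).re)
    -- (z-window∣MW) VERBATIM
    (hwin : ∀ (z : Z) (V : GaugeField (F.P j) 0 ↥(Matrix.specialUnitaryGroup (Fin 2) ℂ)) (b : PBond (F.P j) 0) (u : Fin 3 → ℝ), PlaqSmall (θBal F.L γ b₀ p₀ j) V →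
      PlaqSmall (θBal F.L γ b₀ p₀ j) (update V b (V b * expPt u)) → ‖u‖ ≤ δ₀ →
      (∀ r ∈ Set.Ioo (0:ℝ) 1, ∀ (n : ℕ) (hjn : j + 1 ≤ n) (hnK : n ≤ Ts), PlaqSmall (24 / 25 * θBal F.L γ b₀ p₀ n) (descendTo F ℰp n Ts hnK (Φ (update V b (V b * expPt (r • u)), z)))) →
      ∀ j', ‖coord z j'‖ ≤ Zw)
    (kW : PBond (F.P Ts) 0 → ℝ)
    (hkW : ∀ e k, (4 / (r / (1 + r) * R₁)) *
          (∑ j', (B ^ (1 - lam r) * (max B (2 / Real.sqrt (γK / 2))) ^ lam r) * Real.exp (-((1 - lam r) * ρ * tdist1 Nf (loc (idx e k)) (loc j')))) * Zw ≤ kW e) :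
    ∀ (z : Z) (V : GaugeField (F.P j) 0 ↥(Matrix.specialUnitaryGroup (Fin 2) ℂ)) (b : PBond (F.P j) 0) (u : Fin 3 → ℝ), PlaqSmall (θBal F.L γ b₀ p₀ j) V →
      PlaqSmall (θBal F.L γ b₀ p₀ j) (update V b (V b * expPt u)) → ‖u‖ ≤ δ₀ →
      (∀ r ∈ Set.Ioo (0:ℝ) 1, ∀ (n : ℕ) (hjn : j + 1 ≤ n) (hnK : n ≤ Ts), PlaqSmall (24 / 25 * θBal F.L γ b₀ p₀ n) (descendTo F ℰp n Ts hnK (Φ (update V b (V b * expPt (r • u)), z)))) →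
      ∀ e, ‖Wh (update V b (V b * expPt u)) z e - Wh V z e‖ ≤ kW e * ‖u‖ := by
  have h3 : 0 ≤ Real.sqrt 3 := Real.sqrt_nonneg 3
  refine dwhite_of_tubeOperator F γ b₀ p₀ j Ts Φ Wh loc idx coord Kc K (θBal F.L γ b₀ p₀ j + 4 * (Real.sqrt 3 * R₁)) ?_ δt rt hrt0 hrt
    Mx S hS hrow hcol hKc hKM hKreal γK hγK hcoer ρ B hB0 hρ hdec R₁ r δ₀ Zw hR₁ hR₁rt hsmall hr0 hr1 hZw hδ₀R ?_ hWh hwin kW hkW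
  · -- (window⁺): monotonicity of the window
    intro V hV
    exact plaqSmall_mono (by nlinarith [hR₁.le]) hV
  · -- (room): a one-bond move of size `‖u‖ < R₁` widens the window by `≤ 4·√3·‖u‖`
    intro V b u hV hu
    have h := plaqSmall_relPath (B' := b) (m' := u) (X := fun s : ℝ => update V b (V b * expPt (s • u))) hV
      (fun s e he => update_of_ne he _ _) (fun s => update_self _ _ _) 1
    simp only [one_smul, abs_one, one_mul] at h
    exact plaqSmall_mono (by nlinarith [mul_le_mul_of_nonneg_left hu.le h3]) h

end Dock

end Summit.QuantumFields.YangMills.Theorems.OrganTangentDwhiteOfTubeOperator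

end
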